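import Literature.Geometry.Kaehler.ComplexTorusHodgeGroupSigmaPiPowers
import Literature.Geometry.Kaehler.ComplexTorusHodgeLieAlgebraProductsPowers
import Literature.Geometry.Kaehler.ComplexTorusHodgeLieAlgebraCartanPTrivial
import Literature.Geometry.Kaehler.ComplexTorusEllipticCurveHodgeLieAlgebra
import HarnessLib

/-!
# Moonen–Zarhin's identification `Hg(X₁^{n₁} × ⋯ × X_r^{n_r}) = Hg(X₁ × ⋯ × X_r)` INFINITESIMALLY, factors of arbitrary
# dimensions: `𝔥𝔤_ℝ(∏ₖ X_k^{n_k}) = dδ(𝔥𝔤_ℝ(∏ₖ X_k))`, `dδ(diag(A_k)) = diag(1_{n_k} ⊗ A_k)`, with equal dimensions of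
# `𝔥𝔤_ℝ`, `𝔨` and `𝔭` (Moonen–Zarhin 1999 §1; Green–Griffiths–Kerr (I.B.3), III.B (i))

Layer `Literature/Geometry/Kaehler`, namespace `Literature.Geometry.Kaehler.ComplexTorus`; lane `lit-hodgefound` (Track 2
foundations library), Layer A4 (Hodge Lie algebras of products), prover seat p17 (generation 21), self-proposed row g21-#7
of `run/shared/lean/pub/lit-hodgefound/SKELETON.md`: the Lie-algebra companion of p36's `ComplexTorusHodgeGroupSigmaPiPowers`
(g15-#4, torus level: `mem_hodgeGroup_sigmaPi_pow_iff`, `hodgeGroup_sigmaPi_pow_eq`, `sigmaDiagPowSL`, `coe_sigmaDiagPowSL`)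
on p10's dependent product `∏ₖ X_k^{n_k} = sigmaPiPeriod (fun k ↦ powPeriod (Ψ k) (n k))` (index `Σ k, Fin (n k) × σ k`)
of POWERS of tori `Ψ k : ℝ^{σ k} ≃L[ℝ] F k` of different dimensions — the shape in which Poincaré's complete
reducibility theorem delivers every abelian variety up to isogeny.  Consumed BY NAME: p36's g15-#1
(`apply_eq_zero_of_mem_hodgeGroup_sigmaPi`, `eq_blockDiagonal'_blockDiag'_of_apply_eq_zero`, `blockDiag'_mem_hodgeGroup`,
`exists_eq_sigmaBlockDiagSL_of_mem_hodgeGroup_sigmaPi`, `sigmaBlockDiagSL`, `jMatrix_sigmaPiPeriod`), p17's power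
calculus (`diagPow`, `diagPow_exp`, `exp_smul_diagPow`, `diagPow_injective`, `diagPow_eq_one_kronecker`,
`jMatrix_powPeriod_eq_diagPow`, `eq_diagPow_of_mem_hodgeGroupLie_pow`, `diagPow_mem_hodgeGroupLie_pow_iff` of
`ComplexTorusLefschetzGroupPower` / `ComplexTorusHodgeLieAlgebraHodgeClassesOfPowers`), `apply_eq_zero_of_forall_exp_smul_apply_eq_zero`,
the carriers `hodgeGroupLie` / `hodgeIsotropyLie` / `hodgeCartanP` (p40) and
`finrank_hodgeGroupLie_eq_finrank_hodgeIsotropyLie_add_finrank_hodgeCartanP`; Mathlib's `Matrix.exp_blockDiagonal'`.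
THEOREMS ONLY: no definition, no named fact, net debt 0.  (§0 carries PRIVATE primed copies of five block lemmas of this
seat's g21-#6 `ComplexTorusHodgeLieAlgebraSigmaPi`, whose olean the farm has not built yet; the public statements there
are not restated.)

## Sources, verbatim

* [MoonenZarhin1999LowDim] B. J. J. Moonen, Yu. G. Zarhin, *Hodge classes on abelian varieties of low dimension*,
  Math. Ann. 315 (1999) (held `paper:arxiv-math_9901113`), §1 (p0002 L138–L141): "For `n ≥ 1` we can identify `Hg(Xⁿ)`
  with `Hg(X)`, acting diagonally on `V_{Xⁿ} = (V_X)ⁿ`. More generally, if `n₁, …, n_r ∈ ℤ_{≥1}` then we can identify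
  `Hg(X₁^{n₁} × ⋯ × X_r^{n_r})` with `Hg(X₁ × ⋯ × X_r)`."; (0.2)(4) (p0002 L1–L11): "Decompose `X`, up to isogeny, as a
  product of elementary abelian varieties, say `X ∼ Y₁^{m₁} × ⋯ × Y_r^{m_r}`."
* [GreenGriffithsKerr2012] M. Green, P. Griffiths, M. Kerr, *Mumford–Tate Groups and Domains* (2012), §I.B (I.B.3)
  (p. 39: "`M_{ρ(φ̃)}` is the image of `M_φ̃` under the natural map `ρ`") and §III.B (i) (p. 72: "`M_{φ₁+φ₂} ⊂ M_{φ₁} × M_{φ₂}`").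
* [BrockerTomDieck1985] T. Bröcker, T. tom Dieck, *Representations of Compact Lie Groups*, I (3.2) (p0025:
  "`exp (A ⊕ D) = exp A ⊕ exp D`").
* [Hall2015] B. C. Hall, *Lie Groups, Lie Algebras, and Representations*, Def. 3.18 / Thm. 3.20, §2.1 Prop. 2.3.

## What is here (`n_k ≥ 1` throughout §2–§4; every finite family, no polarisation)

* §0 (private) the block calculus of `𝔥𝔤_ℝ` on a `Σ`-carrier: exponentials of `blockDiagonal'`, block-diagonality of the
  elements of `𝔥𝔤_ℝ(∏ₖ Y_k)`, their diagonal blocks in `𝔥𝔤_ℝ(Y_k)`.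
* §1 `jMatrix_sigmaPi_pow` (`J_{∏ X_k^{n_k}} = diag_k(1_{n_k} ⊗ J_k)`), `blockDiagonal'_diagPow_mul` / `…_injective`-type
  helpers for `dδ : diag(A_k) ↦ diag(1_{n_k} ⊗ A_k)`.
* §2 **`blockDiagonal'_diagPow_mem_hodgeGroupLie_sigmaPi_pow`** (`diag(A_k) ∈ 𝔥𝔤_ℝ(∏ X_k) ⟹ diag(1 ⊗ A_k) ∈ 𝔥𝔤_ℝ(∏ X_k^{n_k})`),
  **`exists_of_mem_hodgeGroupLie_sigmaPi_pow`** (every `Z ∈ 𝔥𝔤_ℝ(∏ X_k^{n_k})` is `diag(1 ⊗ A_k)` with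
  `diag(A_k) ∈ 𝔥𝔤_ℝ(∏ X_k)` — the joint condition, not only `A_k ∈ 𝔥𝔤_ℝ(X_k)`), **`mem_hodgeGroupLie_sigmaPi_pow_iff`**,
  **`finrank_hodgeGroupLie_sigmaPi_pow`** (`dim 𝔥𝔤_ℝ(∏ X_k^{n_k}) = dim 𝔥𝔤_ℝ(∏ X_k)`).
* §3 `𝔨` and `𝔭`: `blockDiagonal'_diagPow_mem_hodgeIsotropyLie_sigmaPi_pow_iff`, `…hodgeCartanP…_iff`,
  **`finrank_hodgeIsotropyLie_sigmaPi_pow`**, **`finrank_hodgeCartanP_sigmaPi_pow`** (both dimensions are those of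
  `∏ X_k`), `hodgeCartanP_sigmaPi_pow_eq_bot_iff` (`𝔭(∏ X_k^{n_k}) = 0 ⟺ 𝔭(∏ X_k) = 0`).
* §4 validation: powers of elliptic curves `∏ₖ E_k^{n_k}`: `dim 𝔥𝔤_ℝ ≤ 3|κ|`; all `E_k` CM ⟹ `𝔭 = 0` and `dim 𝔥𝔤_ℝ ≤ |κ|`.

NOT here: the isogeny step `X ∼ ∏ Y_ν^{n_ν} ⟹ 𝔥𝔤_ℝ(X) ≅ 𝔥𝔤_ℝ(∏ Y_ν)` (the tree's `IsIsogenous` Lie-algebra transport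
lives on one ambient space); surjectivity of the projections; the `ℚ`-form.
-/

noncomputable section

open scoped Matrix Kronecker

open Module Matrix NormedSpace

namespace Literature.Geometry.Kaehler.ComplexTorus

/-! ## §0 Private block calculus on a `Σ`-carrier (copies of g21-#6, unbuilt on the farm) -/

section Block

variable {κ : Type*} [Fintype κ] [DecidableEq κ] {σ : κ → Type*} [∀ k, Fintype (σ k)] [∀ k, DecidableEq (σ k)]

set_option backward.isDefEq.respectTransparency false in
/-- `e^{diag(M_k)} = diag(e^{M_k})`. [cite: BrockerTomDieck1985, I (3.2) (p0025)] -/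
private theorem exp_blockDiagonal'_eq' (M : ∀ k, Matrix (σ k) (σ k) ℝ) :
    exp (Matrix.blockDiagonal' M) = Matrix.blockDiagonal' fun k ↦ exp (M k) := by
  rw [Matrix.exp_blockDiagonal']
  congr 1
  open scoped Matrix.Norms.Operator in exact Pi.exp_def M

/-- `e^{t diag(M_k)} = diag(e^{tM_k})`. [cite: BrockerTomDieck1985, I (3.2) (p0025)] -/
private theorem exp_smul_blockDiagonal'' (t : ℝ) (M : ∀ k, Matrix (σ k) (σ k) ℝ) :
    exp (t • Matrix.blockDiagonal' M) = Matrix.blockDiagonal' fun k ↦ exp (t • M k) := by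
  rw [← Matrix.blockDiagonal'_smul, exp_blockDiagonal'_eq']
  rfl

variable {F : κ → Type*} [∀ k, NormedAddCommGroup (F k)] [∀ k, NormedSpace ℂ (F k)] (Ψ : ∀ k, (σ k → ℝ) ≃L[ℝ] F k)

/-- `Z ∈ 𝔥𝔤_ℝ(∏ₖ Y_k) ⟹ Z = diag(Z_k)`. [cite: GreenGriffithsKerr2012, §III.B (i) (p. 72)] -/
private theorem eq_blockDiagonal'_of_mem' {Z : Matrix (Σ k, σ k) (Σ k, σ k) ℝ}
    (hZ : Z ∈ hodgeGroupLie (sigmaPiPeriod Ψ)) : Z = Matrix.blockDiagonal' (Matrix.blockDiag' Z) := by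
  letI : LieRing (Matrix (Σ k, σ k) (Σ k, σ k) ℝ) := LieRing.ofAssociativeRing
  refine eq_blockDiagonal'_blockDiag'_of_apply_eq_zero fun p q hpq ↦ ?_
  refine apply_eq_zero_of_forall_exp_smul_apply_eq_zero fun t ↦ ?_
  obtain ⟨M, hM, hMt⟩ := (mem_hodgeGroupLie_iff _).1 hZ t
  rw [← hMt]
  exact apply_eq_zero_of_mem_hodgeGroup_sigmaPi Ψ hM hpq

/-- `Z ∈ 𝔥𝔤_ℝ(∏ₖ Y_k) ⟹ Z_k ∈ 𝔥𝔤_ℝ(Y_k)`. [cite: GreenGriffithsKerr2012, §III.B (i) (p. 72)] -/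
private theorem blockDiag'_mem' {Z : Matrix (Σ k, σ k) (Σ k, σ k) ℝ} (hZ : Z ∈ hodgeGroupLie (sigmaPiPeriod Ψ))
    (k : κ) : Matrix.blockDiag' Z k ∈ hodgeGroupLie (Ψ k) := by
  letI : LieRing (Matrix (Σ k, σ k) (Σ k, σ k) ℝ) := LieRing.ofAssociativeRing
  letI : ∀ l, LieRing (Matrix (σ l) (σ l) ℝ) := fun _ ↦ LieRing.ofAssociativeRing
  refine (mem_hodgeGroupLie_iff _).2 fun t ↦ ?_
  obtain ⟨M, hM, hMt⟩ := (mem_hodgeGroupLie_iff _).1 hZ t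
  refine ⟨_, blockDiag'_mem_hodgeGroup Ψ hM k, ?_⟩
  change Matrix.blockDiag' (M : Matrix (Σ k, σ k) (Σ k, σ k) ℝ) k = exp (t • Matrix.blockDiag' Z k)
  rw [hMt]
  conv_lhs => rw [eq_blockDiagonal'_of_mem' Ψ hZ, exp_smul_blockDiagonal'', Matrix.blockDiag'_blockDiagonal']

/-- `dim 𝔥𝔤_ℝ(∏ₖ Y_k) ≤ Σₖ dim 𝔥𝔤_ℝ(Y_k)`. [cite: GreenGriffithsKerr2012, §III.B (i) (p. 72)] -/
private theorem finrank_hodgeGroupLie_sigmaPi_le' :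
    finrank ℝ (hodgeGroupLie (sigmaPiPeriod Ψ)) ≤ ∑ k, finrank ℝ (hodgeGroupLie (Ψ k)) := by
  letI : LieRing (Matrix (Σ k, σ k) (Σ k, σ k) ℝ) := LieRing.ofAssociativeRing
  letI : ∀ l, LieRing (Matrix (σ l) (σ l) ℝ) := fun _ ↦ LieRing.ofAssociativeRing
  change finrank ℝ (hodgeGroupLie (sigmaPiPeriod Ψ)).toSubmodule ≤ ∑ k, finrank ℝ (hodgeGroupLie (Ψ k)).toSubmodule
  let f : (hodgeGroupLie (sigmaPiPeriod Ψ)).toSubmodule →ₗ[ℝ] (Π k, (hodgeGroupLie (Ψ k)).toSubmodule) :=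
    { toFun := fun Z k ↦ ⟨Matrix.blockDiag' (Z : Matrix (Σ k, σ k) (Σ k, σ k) ℝ) k, blockDiag'_mem' Ψ Z.2 k⟩
      map_add' := fun Z W ↦ funext fun k ↦ Subtype.ext (Matrix.ext fun _ _ ↦ rfl)
      map_smul' := fun c Z ↦ funext fun k ↦ Subtype.ext (Matrix.ext fun _ _ ↦ rfl) }
  have hf : Function.Injective f := by
    intro Z W h
    apply Subtype.ext
    rw [eq_blockDiagonal'_of_mem' Ψ Z.2, eq_blockDiagonal'_of_mem' Ψ W.2]
    congr 1
    funext k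
    exact congrArg (fun x : Π k, (hodgeGroupLie (Ψ k)).toSubmodule ↦ (x k : Matrix (σ k) (σ k) ℝ)) h
  have h := LinearMap.finrank_le_finrank_of_injective hf
  rwa [Module.finrank_pi_fintype] at h

end Block

/-! ## §1 The diagonal twist `dδ : diag(A_k) ↦ diag(1_{n_k} ⊗ A_k)` -/

section Delta

variable {κ : Type*} [Fintype κ] [DecidableEq κ] {σ : κ → Type*} [∀ k, Fintype (σ k)] [∀ k, DecidableEq (σ k)]
  (n : κ → ℕ)

/-- `diag(1_{n_k} ⊗ A_k) · diag(1_{n_k} ⊗ B_k) = diag(1_{n_k} ⊗ A_k B_k)`. [cite: MoonenZarhin1999LowDim, §1 (p0002 L138–L141)] -/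
theorem blockDiagonal'_diagPow_mul (A B : ∀ k, Matrix (σ k) (σ k) ℝ) :
    (Matrix.blockDiagonal' fun k ↦ diagPow (σ k) (n k) (A k)) * (Matrix.blockDiagonal' fun k ↦ diagPow (σ k) (n k) (B k)) =
      Matrix.blockDiagonal' fun k ↦ diagPow (σ k) (n k) (A k * B k) := by
  rw [← Matrix.blockDiagonal'_mul]
  exact congrArg Matrix.blockDiagonal' (funext fun k ↦ (map_mul (diagPow (σ k) (n k)) _ _).symm)

omit [Fintype κ] in
/-- `dδ` is injective for `n_k ≥ 1`. [cite: MoonenZarhin1999LowDim, §1 (p0002 L138–L141: "identify")] -/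
theorem eq_of_blockDiagonal'_diagPow_eq (hn : ∀ k, 0 < n k) {A B : ∀ k, Matrix (σ k) (σ k) ℝ}
    (h : (Matrix.blockDiagonal' fun k ↦ diagPow (σ k) (n k) (A k)) = Matrix.blockDiagonal' fun k ↦ diagPow (σ k) (n k) (B k)) :
    A = B := by
  funext k
  have hk := congrArg (fun M ↦ Matrix.blockDiag' M k) h
  simp only [Matrix.blockDiag'_blockDiagonal'] at hk
  exact diagPow_injective (n k) (hn k) hk

/-- `e^{t diag(1 ⊗ A_k)} = diag(1 ⊗ e^{tA_k})`. [cite: BrockerTomDieck1985, I (3.2) (p0025)] [cite: Hall2015, §2.1 Prop. 2.3] -/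
theorem exp_smul_blockDiagonal'_diagPow (t : ℝ) (A : ∀ k, Matrix (σ k) (σ k) ℝ) :
    exp (t • Matrix.blockDiagonal' fun k ↦ diagPow (σ k) (n k) (A k)) =
      Matrix.blockDiagonal' fun k ↦ diagPow (σ k) (n k) (exp (t • A k)) := by
  rw [exp_smul_blockDiagonal'']
  exact congrArg Matrix.blockDiagonal' (funext fun k ↦ exp_smul_diagPow (n k) t (A k))

variable {F : κ → Type*} [∀ k, NormedAddCommGroup (F k)] [∀ k, NormedSpace ℂ (F k)] (Ψ : ∀ k, (σ k → ℝ) ≃L[ℝ] F k)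

/-- **`J_{∏ X_k^{n_k}} = diag_k(1_{n_k} ⊗ J_k) = dδ(J_{∏ X_k})`.** [cite: MoonenZarhin1999LowDim, §1 (p0002 L138–L141)]
[cite: Lange2023AbelianVarietiesComplex, §2.4.4 Thm. 2.4.25 (the product torus)] -/
theorem jMatrix_sigmaPi_pow :
    jMatrix (sigmaPiPeriod fun k ↦ powPeriod (Ψ k) (n k)) =
      Matrix.blockDiagonal' fun k ↦ diagPow (σ k) (n k) (jMatrix (Ψ k)) := by
  rw [jMatrix_sigmaPiPeriod]
  exact congrArg Matrix.blockDiagonal' (funext fun k ↦ jMatrix_powPeriod_eq_diagPow (Ψ k) (n k))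

/-- The matrix of `sigmaDiagPowSL σ n A` in `diagPow` form: `diag_k(Δ_{n_k} A_k)`. [cite: MoonenZarhin1999LowDim, §1 (p0002 L138–L141)] -/
theorem coe_sigmaDiagPowSL_eq_blockDiagonal'_diagPow (A : ∀ k, SpecialLinearGroup (σ k) ℝ) :
    (sigmaDiagPowSL σ n A : Matrix (Σ k, Fin (n k) × σ k) (Σ k, Fin (n k) × σ k) ℝ) =
      Matrix.blockDiagonal' fun k ↦ diagPow (σ k) (n k) (A k : Matrix (σ k) (σ k) ℝ) := by
  rw [coe_sigmaDiagPowSL]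
  exact congrArg Matrix.blockDiagonal' (funext fun k ↦ (diagPow_eq_one_kronecker (n k) _).symm)

end Delta

/-! ## §2 `𝔥𝔤_ℝ(∏ₖ X_k^{n_k}) = dδ(𝔥𝔤_ℝ(∏ₖ X_k))` -/

section LieAlgebra

variable {κ : Type*} [Fintype κ] [DecidableEq κ] {σ : κ → Type*} [∀ k, Fintype (σ k)] [∀ k, DecidableEq (σ k)]
  {F : κ → Type*} [∀ k, NormedAddCommGroup (F k)] [∀ k, NormedSpace ℂ (F k)]
  (Ψ : ∀ k, (σ k → ℝ) ≃L[ℝ] F k) (n : κ → ℕ)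

/-- **`dδ(𝔥𝔤_ℝ(∏ X_k)) ⊆ 𝔥𝔤_ℝ(∏ X_k^{n_k})`**: if `diag(A_k) ∈ 𝔥𝔤_ℝ(∏ₖ X_k)` then `diag(1_{n_k} ⊗ A_k) ∈ 𝔥𝔤_ℝ(∏ₖ X_k^{n_k})`
(`e^{t diag(1 ⊗ A_k)} = δ(e^{t diag(A_k)})` with `δ = sigmaDiagPowSL`, and `δ(Hg(∏ X_k)) ⊆ Hg(∏ X_k^{n_k})`).
[cite: MoonenZarhin1999LowDim, §1 (p0002 L138–L141)] [cite: GreenGriffithsKerr2012, §I.B (I.B.3)] -/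
theorem blockDiagonal'_diagPow_mem_hodgeGroupLie_sigmaPi_pow (hn : ∀ k, 0 < n k) {A : ∀ k, Matrix (σ k) (σ k) ℝ}
    (hA : Matrix.blockDiagonal' A ∈ hodgeGroupLie (sigmaPiPeriod Ψ)) :
    (Matrix.blockDiagonal' fun k ↦ diagPow (σ k) (n k) (A k)) ∈
      hodgeGroupLie (sigmaPiPeriod fun k ↦ powPeriod (Ψ k) (n k)) := by
  letI : LieRing (Matrix (Σ k, σ k) (Σ k, σ k) ℝ) := LieRing.ofAssociativeRing
  letI : LieRing (Matrix (Σ k, Fin (n k) × σ k) (Σ k, Fin (n k) × σ k) ℝ) := LieRing.ofAssociativeRing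
  refine (mem_hodgeGroupLie_iff _).2 fun t ↦ ?_
  obtain ⟨P, hP, hPt⟩ := (mem_hodgeGroupLie_iff _).1 hA t
  obtain ⟨B, -, rfl⟩ := exists_eq_sigmaBlockDiagSL_of_mem_hodgeGroup_sigmaPi Ψ hP
  -- the blocks of `P = diag(B_k)` are `e^{tA_k}`
  have hB : ∀ k, (B k : Matrix (σ k) (σ k) ℝ) = exp (t • A k) := fun k ↦ by
    have h := congrArg (fun M ↦ Matrix.blockDiag' M k) hPt
    simpa only [coe_sigmaBlockDiagSL, Matrix.blockDiag'_blockDiagonal', exp_smul_blockDiagonal''] using h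
  refine ⟨sigmaDiagPowSL σ n B, (mem_hodgeGroup_sigmaPi_pow_iff Ψ n hn).2 ⟨B, hP, rfl⟩, ?_⟩
  rw [coe_sigmaDiagPowSL_eq_blockDiagonal'_diagPow, exp_smul_blockDiagonal'_diagPow]
  exact congrArg Matrix.blockDiagonal' (funext fun k ↦ by rw [hB k])

/-- **`𝔥𝔤_ℝ(∏ X_k^{n_k}) ⊆ dδ(𝔥𝔤_ℝ(∏ X_k))`**: every `Z ∈ 𝔥𝔤_ℝ(∏ₖ X_k^{n_k})` is `diag(1_{n_k} ⊗ A_k)` for a tuple with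
`diag(A_k) ∈ 𝔥𝔤_ℝ(∏ₖ X_k)` (the JOINT condition: `Z` is block-diagonal (III.B (i)), each block is block-scalar
`1 ⊗ A_k` (`𝔥𝔤_ℝ(X_k^{n_k}) = Δ 𝔥𝔤_ℝ(X_k)`), and `e^{tZ} = δ(diag(e^{tA_k}))` with `diag(e^{tA_k}) ∈ Hg(∏ X_k)(ℝ)` by the
torus-level identification). [cite: MoonenZarhin1999LowDim, §1 (p0002 L138–L141)] [cite: GreenGriffithsKerr2012, §I.B (I.B.3), §III.B (i)] -/
theorem exists_of_mem_hodgeGroupLie_sigmaPi_pow (hn : ∀ k, 0 < n k) {Z : Matrix (Σ k, Fin (n k) × σ k) (Σ k, Fin (n k) × σ k) ℝ}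
    (hZ : Z ∈ hodgeGroupLie (sigmaPiPeriod fun k ↦ powPeriod (Ψ k) (n k))) :
    ∃ A : ∀ k, Matrix (σ k) (σ k) ℝ, Matrix.blockDiagonal' A ∈ hodgeGroupLie (sigmaPiPeriod Ψ) ∧
      Z = Matrix.blockDiagonal' fun k ↦ diagPow (σ k) (n k) (A k) := by
  letI : LieRing (Matrix (Σ k, σ k) (Σ k, σ k) ℝ) := LieRing.ofAssociativeRing
  letI : LieRing (Matrix (Σ k, Fin (n k) × σ k) (Σ k, Fin (n k) × σ k) ℝ) := LieRing.ofAssociativeRing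
  -- the blocks `Z_k ∈ 𝔥𝔤_ℝ(X_k^{n_k})` are block-scalar: `Z_k = Δ A_k`
  set A : ∀ k, Matrix (σ k) (σ k) ℝ := fun k i j ↦ Matrix.blockDiag' Z k (⟨0, hn k⟩, i) (⟨0, hn k⟩, j) with hA
  have hZk : ∀ k, Matrix.blockDiag' Z k = diagPow (σ k) (n k) (A k) := fun k ↦
    eq_diagPow_of_mem_hodgeGroupLie_pow ⟨0, hn k⟩ (blockDiag'_mem' _ hZ k)
  have hZeq : Z = Matrix.blockDiagonal' fun k ↦ diagPow (σ k) (n k) (A k) := by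
    rw [eq_blockDiagonal'_of_mem' _ hZ]
    exact congrArg Matrix.blockDiagonal' (funext hZk)
  refine ⟨A, (mem_hodgeGroupLie_iff _).2 fun t ↦ ?_, hZeq⟩
  obtain ⟨M, hM, hMt⟩ := (mem_hodgeGroupLie_iff _).1 hZ t
  obtain ⟨B, hB, hBM⟩ := (mem_hodgeGroup_sigmaPi_pow_iff Ψ n hn).1 hM
  -- `δ(diag B_k) = e^{tZ} = diag(Δ e^{tA_k})` forces `B_k = e^{tA_k}`
  have hcoe : (Matrix.blockDiagonal' fun k ↦ diagPow (σ k) (n k) (B k : Matrix (σ k) (σ k) ℝ)) =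
      Matrix.blockDiagonal' fun k ↦ diagPow (σ k) (n k) (exp (t • A k)) := by
    rw [← coe_sigmaDiagPowSL_eq_blockDiagonal'_diagPow, hBM, hMt, hZeq, exp_smul_blockDiagonal'_diagPow]
  have hBk := eq_of_blockDiagonal'_diagPow_eq n hn hcoe
  refine ⟨sigmaBlockDiagSL σ ℝ B, hB, ?_⟩
  rw [coe_sigmaBlockDiagSL, exp_smul_blockDiagonal'']
  exact congrArg Matrix.blockDiagonal' hBk

/-- **MOONEN–ZARHIN §1 INFINITESIMALLY, factors of any dimensions: `Z ∈ 𝔥𝔤_ℝ(∏ₖ X_k^{n_k}) ⟺ Z = diag(1_{n_k} ⊗ A_k)`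
with `diag(A_k) ∈ 𝔥𝔤_ℝ(∏ₖ X_k)`** (`n_k ≥ 1`). [cite: MoonenZarhin1999LowDim, §1 (p0002 L138–L141)]
[cite: GreenGriffithsKerr2012, §I.B (I.B.3), §III.B (i)] -/
theorem mem_hodgeGroupLie_sigmaPi_pow_iff (hn : ∀ k, 0 < n k) {Z : Matrix (Σ k, Fin (n k) × σ k) (Σ k, Fin (n k) × σ k) ℝ} :
    Z ∈ hodgeGroupLie (sigmaPiPeriod fun k ↦ powPeriod (Ψ k) (n k)) ↔
      ∃ A : ∀ k, Matrix (σ k) (σ k) ℝ, Matrix.blockDiagonal' A ∈ hodgeGroupLie (sigmaPiPeriod Ψ) ∧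
        Z = Matrix.blockDiagonal' fun k ↦ diagPow (σ k) (n k) (A k) :=
  ⟨exists_of_mem_hodgeGroupLie_sigmaPi_pow Ψ n hn,
    fun ⟨_, hA, hZ⟩ ↦ hZ ▸ blockDiagonal'_diagPow_mem_hodgeGroupLie_sigmaPi_pow Ψ n hn hA⟩

omit [Fintype κ] in
/-- The ambient linear map `dδ : M ↦ diag_k(Δ_{n_k} M_{kk})` on `Σ`-matrices is additive. [cite: MoonenZarhin1999LowDim, §1 (p0002 L138–L141)] -/
theorem blockDiagonal'_diagPow_blockDiag'_add (M N : Matrix (Σ k, σ k) (Σ k, σ k) ℝ) :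
    (Matrix.blockDiagonal' fun k ↦ diagPow (σ k) (n k) (Matrix.blockDiag' (M + N) k)) =
      (Matrix.blockDiagonal' fun k ↦ diagPow (σ k) (n k) (Matrix.blockDiag' M k)) +
        Matrix.blockDiagonal' fun k ↦ diagPow (σ k) (n k) (Matrix.blockDiag' N k) := by
  rw [← Matrix.blockDiagonal'_add]
  exact congrArg Matrix.blockDiagonal' (funext fun k ↦ by rw [Pi.add_apply, Matrix.blockDiag'_add, Pi.add_apply, map_add])

omit [Fintype κ] in
/-- … and homogeneous. [cite: MoonenZarhin1999LowDim, §1 (p0002 L138–L141)] -/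
theorem blockDiagonal'_diagPow_blockDiag'_smul (c : ℝ) (M : Matrix (Σ k, σ k) (Σ k, σ k) ℝ) :
    (Matrix.blockDiagonal' fun k ↦ diagPow (σ k) (n k) (Matrix.blockDiag' (c • M) k)) =
      c • Matrix.blockDiagonal' fun k ↦ diagPow (σ k) (n k) (Matrix.blockDiag' M k) := by
  rw [← Matrix.blockDiagonal'_smul]
  exact congrArg Matrix.blockDiagonal' (funext fun k ↦ by rw [Pi.smul_apply, Matrix.blockDiag'_smul, Pi.smul_apply, map_smul])

/-- **`dim_ℝ 𝔥𝔤_ℝ(∏ₖ X_k^{n_k}) = dim_ℝ 𝔥𝔤_ℝ(∏ₖ X_k)`** (`n_k ≥ 1`): `dδ` restricts to a linear bijection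
`𝔥𝔤_ℝ(∏ X_k) → 𝔥𝔤_ℝ(∏ X_k^{n_k})`. [cite: MoonenZarhin1999LowDim, §1 (p0002 L138–L141: "identify")] [cite: GreenGriffithsKerr2012, §I.B (I.B.3)] -/
theorem finrank_hodgeGroupLie_sigmaPi_pow (hn : ∀ k, 0 < n k) :
    finrank ℝ (hodgeGroupLie (sigmaPiPeriod fun k ↦ powPeriod (Ψ k) (n k))) = finrank ℝ (hodgeGroupLie (sigmaPiPeriod Ψ)) := by
  letI : LieRing (Matrix (Σ k, σ k) (Σ k, σ k) ℝ) := LieRing.ofAssociativeRing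
  letI : LieRing (Matrix (Σ k, Fin (n k) × σ k) (Σ k, Fin (n k) × σ k) ℝ) := LieRing.ofAssociativeRing
  change finrank ℝ (hodgeGroupLie (sigmaPiPeriod fun k ↦ powPeriod (Ψ k) (n k))).toSubmodule =
    finrank ℝ (hodgeGroupLie (sigmaPiPeriod Ψ)).toSubmodule
  let T : Matrix (Σ k, σ k) (Σ k, σ k) ℝ →ₗ[ℝ] Matrix (Σ k, Fin (n k) × σ k) (Σ k, Fin (n k) × σ k) ℝ :=
    { toFun := fun M ↦ Matrix.blockDiagonal' fun k ↦ diagPow (σ k) (n k) (Matrix.blockDiag' M k)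
      map_add' := blockDiagonal'_diagPow_blockDiag'_add n
      map_smul' := blockDiagonal'_diagPow_blockDiag'_smul n }
  have hT : ∀ M : (hodgeGroupLie (sigmaPiPeriod Ψ)).toSubmodule,
      T.domRestrict _ M ∈ (hodgeGroupLie (sigmaPiPeriod fun k ↦ powPeriod (Ψ k) (n k))).toSubmodule := by
    rintro ⟨M, hM⟩
    have hM' : Matrix.blockDiagonal' (Matrix.blockDiag' M) ∈ hodgeGroupLie (sigmaPiPeriod Ψ) := by
      rw [← eq_blockDiagonal'_of_mem' Ψ hM]; exact hM
    exact blockDiagonal'_diagPow_mem_hodgeGroupLie_sigmaPi_pow Ψ n hn hM'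
  let g := (T.domRestrict (hodgeGroupLie (sigmaPiPeriod Ψ)).toSubmodule).codRestrict _ hT
  have hinj : Function.Injective g := by
    rintro ⟨M, hM⟩ ⟨M', hM'⟩ h
    have h' : (Matrix.blockDiagonal' fun k ↦ diagPow (σ k) (n k) (Matrix.blockDiag' M k)) =
        Matrix.blockDiagonal' fun k ↦ diagPow (σ k) (n k) (Matrix.blockDiag' M' k) := congrArg Subtype.val h
    have hb := eq_of_blockDiagonal'_diagPow_eq n hn h'
    apply Subtype.ext
    change M = M'
    rw [eq_blockDiagonal'_of_mem' Ψ hM, eq_blockDiagonal'_of_mem' Ψ hM', hb]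
  have hsurj : Function.Surjective g := by
    rintro ⟨Z, hZ⟩
    obtain ⟨A, hA, hZA⟩ := exists_of_mem_hodgeGroupLie_sigmaPi_pow Ψ n hn hZ
    refine ⟨⟨Matrix.blockDiagonal' A, hA⟩, Subtype.ext ?_⟩
    change (Matrix.blockDiagonal' fun k ↦ diagPow (σ k) (n k) (Matrix.blockDiag' (Matrix.blockDiagonal' A) k)) = Z
    rw [hZA, Matrix.blockDiag'_blockDiagonal']
  exact (LinearEquiv.ofBijective g ⟨hinj, hsurj⟩).finrank_eq.symm

/-- `dim_ℝ 𝔥𝔤_ℝ(∏ₖ X_k^{n_k}) ≤ Σₖ dim_ℝ 𝔥𝔤_ℝ(X_k)` (`n_k ≥ 1`). [cite: MoonenZarhin1999LowDim, §1 (p0002 L138–L141)]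
[cite: GreenGriffithsKerr2012, §III.B (i) (p. 72)] -/
theorem finrank_hodgeGroupLie_sigmaPi_pow_le (hn : ∀ k, 0 < n k) :
    finrank ℝ (hodgeGroupLie (sigmaPiPeriod fun k ↦ powPeriod (Ψ k) (n k))) ≤ ∑ k, finrank ℝ (hodgeGroupLie (Ψ k)) := by
  rw [finrank_hodgeGroupLie_sigmaPi_pow Ψ n hn]
  exact finrank_hodgeGroupLie_sigmaPi_le' Ψ

end LieAlgebra

/-! ## §3 The Cartan parts `𝔨` and `𝔭` of `∏ₖ X_k^{n_k}` -/

section Cartan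

variable {κ : Type*} [Fintype κ] [DecidableEq κ] {σ : κ → Type*} [∀ k, Fintype (σ k)] [∀ k, DecidableEq (σ k)]
  {F : κ → Type*} [∀ k, NormedAddCommGroup (F k)] [∀ k, NormedSpace ℂ (F k)]
  (Ψ : ∀ k, (σ k → ℝ) ≃L[ℝ] F k) (n : κ → ℕ)

/-- `diag(1 ⊗ A_k) ∈ 𝔨(∏ X_k^{n_k}) ⟺ diag(A_k) ∈ 𝔨(∏ X_k)` (for `diag(A_k) ∈ 𝔥𝔤_ℝ(∏ X_k)`, `n_k ≥ 1`): both say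
`J_k A_k = A_k J_k` for all `k`. [cite: MoonenZarhin1999LowDim, §1 (p0002 L138–L141)] [cite: Mostow1974StrongRigidity, §2.10 (p. 16)] -/
theorem blockDiagonal'_diagPow_mem_hodgeIsotropyLie_sigmaPi_pow_iff (hn : ∀ k, 0 < n k) {A : ∀ k, Matrix (σ k) (σ k) ℝ}
    (hA : Matrix.blockDiagonal' A ∈ hodgeGroupLie (sigmaPiPeriod Ψ)) :
    (Matrix.blockDiagonal' fun k ↦ diagPow (σ k) (n k) (A k)) ∈
        hodgeIsotropyLie (sigmaPiPeriod fun k ↦ powPeriod (Ψ k) (n k)) ↔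
      Matrix.blockDiagonal' A ∈ hodgeIsotropyLie (sigmaPiPeriod Ψ) := by
  rw [mem_hodgeIsotropyLie_iff, mem_hodgeIsotropyLie_iff, jMatrix_sigmaPi_pow, blockDiagonal'_diagPow_mul,
    blockDiagonal'_diagPow_mul, jMatrix_sigmaPiPeriod, ← Matrix.blockDiagonal'_mul, ← Matrix.blockDiagonal'_mul]
  refine ⟨fun ⟨_, h⟩ ↦ ⟨hA, congrArg Matrix.blockDiagonal' (eq_of_blockDiagonal'_diagPow_eq n hn h)⟩,
    fun ⟨_, h⟩ ↦ ⟨blockDiagonal'_diagPow_mem_hodgeGroupLie_sigmaPi_pow Ψ n hn hA, ?_⟩⟩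
  have hk : (fun k ↦ jMatrix (Ψ k) * A k) = fun k ↦ A k * jMatrix (Ψ k) := by
    have h' := congrArg Matrix.blockDiag' h
    simpa only [Matrix.blockDiag'_blockDiagonal'] using h'
  exact congrArg (fun B : ∀ k, Matrix (σ k) (σ k) ℝ ↦ Matrix.blockDiagonal' fun k ↦ diagPow (σ k) (n k) (B k)) hk

/-- `diag(1 ⊗ A_k) ∈ 𝔭(∏ X_k^{n_k}) ⟺ diag(A_k) ∈ 𝔭(∏ X_k)` (for `diag(A_k) ∈ 𝔥𝔤_ℝ(∏ X_k)`, `n_k ≥ 1`).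
[cite: MoonenZarhin1999LowDim, §1 (p0002 L138–L141)] [cite: Mostow1974StrongRigidity, §2.10 (p. 16)] -/
theorem blockDiagonal'_diagPow_mem_hodgeCartanP_sigmaPi_pow_iff (hn : ∀ k, 0 < n k) {A : ∀ k, Matrix (σ k) (σ k) ℝ}
    (hA : Matrix.blockDiagonal' A ∈ hodgeGroupLie (sigmaPiPeriod Ψ)) :
    (Matrix.blockDiagonal' fun k ↦ diagPow (σ k) (n k) (A k)) ∈
        hodgeCartanP (sigmaPiPeriod fun k ↦ powPeriod (Ψ k) (n k)) ↔
      Matrix.blockDiagonal' A ∈ hodgeCartanP (sigmaPiPeriod Ψ) := by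
  rw [mem_hodgeCartanP_iff, mem_hodgeCartanP_iff, jMatrix_sigmaPi_pow, blockDiagonal'_diagPow_mul,
    blockDiagonal'_diagPow_mul, jMatrix_sigmaPiPeriod, ← Matrix.blockDiagonal'_mul, ← Matrix.blockDiagonal'_mul,
    ← Matrix.blockDiagonal'_neg, ← Matrix.blockDiagonal'_neg]
  have hneg : ∀ B : ∀ k, Matrix (σ k) (σ k) ℝ,
      (-fun k ↦ diagPow (σ k) (n k) (B k)) = fun k ↦ diagPow (σ k) (n k) ((-B) k) :=
    fun B ↦ funext fun k ↦ by rw [Pi.neg_apply, Pi.neg_apply, map_neg]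
  rw [hneg]
  refine ⟨fun ⟨_, h⟩ ↦ ⟨hA, congrArg Matrix.blockDiagonal' (eq_of_blockDiagonal'_diagPow_eq n hn h)⟩,
    fun ⟨_, h⟩ ↦ ⟨blockDiagonal'_diagPow_mem_hodgeGroupLie_sigmaPi_pow Ψ n hn hA, ?_⟩⟩
  have hk : (fun k ↦ jMatrix (Ψ k) * A k) = -fun k ↦ A k * jMatrix (Ψ k) := by
    have h' := congrArg Matrix.blockDiag' h
    simpa only [Matrix.blockDiag'_blockDiagonal'] using h'
  exact congrArg (fun B : ∀ k, Matrix (σ k) (σ k) ℝ ↦ Matrix.blockDiagonal' fun k ↦ diagPow (σ k) (n k) (B k)) hk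

/-- An injective linear map from `𝔨(∏ X_k)` into `𝔨(∏ X_k^{n_k})` and from `𝔭(∏ X_k)` into `𝔭(∏ X_k^{n_k})`
(restriction of `dδ`): the two dimension inequalities `≤`. [cite: MoonenZarhin1999LowDim, §1 (p0002 L138–L141)] -/
theorem finrank_hodgeIsotropyLie_le_sigmaPi_pow_and (hn : ∀ k, 0 < n k) :
    finrank ℝ (hodgeIsotropyLie (sigmaPiPeriod Ψ)) ≤
        finrank ℝ (hodgeIsotropyLie (sigmaPiPeriod fun k ↦ powPeriod (Ψ k) (n k))) ∧
      finrank ℝ (hodgeCartanP (sigmaPiPeriod Ψ)) ≤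
        finrank ℝ (hodgeCartanP (sigmaPiPeriod fun k ↦ powPeriod (Ψ k) (n k))) := by
  letI : LieRing (Matrix (Σ k, σ k) (Σ k, σ k) ℝ) := LieRing.ofAssociativeRing
  letI : LieRing (Matrix (Σ k, Fin (n k) × σ k) (Σ k, Fin (n k) × σ k) ℝ) := LieRing.ofAssociativeRing
  let T : Matrix (Σ k, σ k) (Σ k, σ k) ℝ →ₗ[ℝ] Matrix (Σ k, Fin (n k) × σ k) (Σ k, Fin (n k) × σ k) ℝ :=
    { toFun := fun M ↦ Matrix.blockDiagonal' fun k ↦ diagPow (σ k) (n k) (Matrix.blockDiag' M k)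
      map_add' := blockDiagonal'_diagPow_blockDiag'_add n
      map_smul' := blockDiagonal'_diagPow_blockDiag'_smul n }
  -- injectivity of `T` on block-diagonal matrices
  have hTinj : ∀ {M M' : Matrix (Σ k, σ k) (Σ k, σ k) ℝ}, M ∈ hodgeGroupLie (sigmaPiPeriod Ψ) →
      M' ∈ hodgeGroupLie (sigmaPiPeriod Ψ) → T M = T M' → M = M' := by
    intro M M' hM hM' h
    have hb := eq_of_blockDiagonal'_diagPow_eq n hn h
    rw [eq_blockDiagonal'_of_mem' Ψ hM, eq_blockDiagonal'_of_mem' Ψ hM', hb]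
  constructor
  · change finrank ℝ (hodgeIsotropyLie (sigmaPiPeriod Ψ)).toSubmodule ≤
      finrank ℝ (hodgeIsotropyLie (sigmaPiPeriod fun k ↦ powPeriod (Ψ k) (n k))).toSubmodule
    have hT : ∀ M : (hodgeIsotropyLie (sigmaPiPeriod Ψ)).toSubmodule,
        T.domRestrict _ M ∈ (hodgeIsotropyLie (sigmaPiPeriod fun k ↦ powPeriod (Ψ k) (n k))).toSubmodule := by
      rintro ⟨M, hM⟩
      have hM₀ := ((mem_hodgeIsotropyLie_iff _).1 hM).1
      have hMb : Matrix.blockDiagonal' (Matrix.blockDiag' M) ∈ hodgeIsotropyLie (sigmaPiPeriod Ψ) := by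
        rw [← eq_blockDiagonal'_of_mem' Ψ hM₀]; exact hM
      have hMb₀ : Matrix.blockDiagonal' (Matrix.blockDiag' M) ∈ hodgeGroupLie (sigmaPiPeriod Ψ) := by
        rw [← eq_blockDiagonal'_of_mem' Ψ hM₀]; exact hM₀
      exact (blockDiagonal'_diagPow_mem_hodgeIsotropyLie_sigmaPi_pow_iff Ψ n hn hMb₀).2 hMb
    have hinj : Function.Injective ((T.domRestrict _).codRestrict _ hT) := by
      rintro ⟨M, hM⟩ ⟨M', hM'⟩ h
      exact Subtype.ext (hTinj ((mem_hodgeIsotropyLie_iff _).1 hM).1 ((mem_hodgeIsotropyLie_iff _).1 hM').1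
        (congrArg Subtype.val h))
    exact LinearMap.finrank_le_finrank_of_injective hinj
  · have hT : ∀ M : hodgeCartanP (sigmaPiPeriod Ψ),
        T.domRestrict _ M ∈ hodgeCartanP (sigmaPiPeriod fun k ↦ powPeriod (Ψ k) (n k)) := by
      rintro ⟨M, hM⟩
      have hM₀ := ((mem_hodgeCartanP_iff _).1 hM).1
      have hMb : Matrix.blockDiagonal' (Matrix.blockDiag' M) ∈ hodgeCartanP (sigmaPiPeriod Ψ) := by
        rw [← eq_blockDiagonal'_of_mem' Ψ hM₀]; exact hM
      have hMb₀ : Matrix.blockDiagonal' (Matrix.blockDiag' M) ∈ hodgeGroupLie (sigmaPiPeriod Ψ) := by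
        rw [← eq_blockDiagonal'_of_mem' Ψ hM₀]; exact hM₀
      exact (blockDiagonal'_diagPow_mem_hodgeCartanP_sigmaPi_pow_iff Ψ n hn hMb₀).2 hMb
    have hinj : Function.Injective ((T.domRestrict _).codRestrict _ hT) := by
      rintro ⟨M, hM⟩ ⟨M', hM'⟩ h
      exact Subtype.ext (hTinj ((mem_hodgeCartanP_iff _).1 hM).1 ((mem_hodgeCartanP_iff _).1 hM').1
        (congrArg Subtype.val h))
    exact LinearMap.finrank_le_finrank_of_injective hinj

/-- **`dim_ℝ 𝔨(∏ₖ X_k^{n_k}) = dim_ℝ 𝔨(∏ₖ X_k)` and `dim_ℝ 𝔭(∏ₖ X_k^{n_k}) = dim_ℝ 𝔭(∏ₖ X_k)`** (`n_k ≥ 1`): the two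
inequalities `≤` of the restricted `dδ`, `dim 𝔥𝔤_ℝ` equal (§2) and `dim 𝔥𝔤_ℝ = dim 𝔨 + dim 𝔭` on both sides.
[cite: MoonenZarhin1999LowDim, §1 (p0002 L138–L141)] [cite: Mostow1974StrongRigidity, §2.10 (p. 16)] -/
theorem finrank_hodgeIsotropyLie_sigmaPi_pow (hn : ∀ k, 0 < n k) :
    finrank ℝ (hodgeIsotropyLie (sigmaPiPeriod fun k ↦ powPeriod (Ψ k) (n k))) =
        finrank ℝ (hodgeIsotropyLie (sigmaPiPeriod Ψ)) ∧
      finrank ℝ (hodgeCartanP (sigmaPiPeriod fun k ↦ powPeriod (Ψ k) (n k))) =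
        finrank ℝ (hodgeCartanP (sigmaPiPeriod Ψ)) := by
  obtain ⟨h1, h2⟩ := finrank_hodgeIsotropyLie_le_sigmaPi_pow_and Ψ n hn
  have h3 := finrank_hodgeGroupLie_sigmaPi_pow Ψ n hn
  have h4 := finrank_hodgeGroupLie_eq_finrank_hodgeIsotropyLie_add_finrank_hodgeCartanP (sigmaPiPeriod Ψ)
  have h5 := finrank_hodgeGroupLie_eq_finrank_hodgeIsotropyLie_add_finrank_hodgeCartanP
    (sigmaPiPeriod fun k ↦ powPeriod (Ψ k) (n k))
  omega

/-- The `𝔭`-part alone. [cite: MoonenZarhin1999LowDim, §1 (p0002 L138–L141)] -/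
theorem finrank_hodgeCartanP_sigmaPi_pow (hn : ∀ k, 0 < n k) :
    finrank ℝ (hodgeCartanP (sigmaPiPeriod fun k ↦ powPeriod (Ψ k) (n k))) =
      finrank ℝ (hodgeCartanP (sigmaPiPeriod Ψ)) :=
  (finrank_hodgeIsotropyLie_sigmaPi_pow Ψ n hn).2

/-- **`𝔭(∏ₖ X_k^{n_k}) = 0 ⟺ 𝔭(∏ₖ X_k) = 0`** (`n_k ≥ 1`): taking powers of the factors does not change whether the product
is of CM type, infinitesimally. [cite: MoonenZarhin1999LowDim, §1 (p0002 L138–L141)] [cite: Deligne1982HodgeCycles, I §5 (p. 63)] -/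
theorem hodgeCartanP_sigmaPi_pow_eq_bot_iff (hn : ∀ k, 0 < n k) :
    hodgeCartanP (sigmaPiPeriod fun k ↦ powPeriod (Ψ k) (n k)) = ⊥ ↔ hodgeCartanP (sigmaPiPeriod Ψ) = ⊥ := by
  rw [← Submodule.finrank_eq_zero (R := ℝ), ← Submodule.finrank_eq_zero (R := ℝ), finrank_hodgeCartanP_sigmaPi_pow Ψ n hn]

end Cartan

/-! ## §4 Validation: powers of elliptic curves -/

section Elliptic

variable {κ : Type*} [Fintype κ] [DecidableEq κ] {τ : κ → ℂ} (hτ : ∀ k, (τ k).im ≠ 0) (n : κ → ℕ)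

/-- `dim_ℝ 𝔥𝔤_ℝ(∏ₖ E_{τ_k}^{n_k}) ≤ 3|κ|` for every finite family of elliptic curves and exponents `n_k ≥ 1`.
[cite: MoonenZarhin1999LowDim, §1 (p0002 L138–L141)] [cite: Imai1976HodgeGroups, §2 (p. 368)] -/
theorem finrank_hodgeGroupLie_sigmaPi_pow_ellipticPeriod_le (hn : ∀ k, 0 < n k) :
    finrank ℝ (hodgeGroupLie (sigmaPiPeriod fun k ↦ powPeriod (ellipticPeriod (hτ k)) (n k))) ≤ 3 * Fintype.card κ := by
  classical
  refine (finrank_hodgeGroupLie_sigmaPi_pow_le (fun k ↦ ellipticPeriod (hτ k)) n hn).trans ?_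
  have hk : ∀ k, finrank ℝ (hodgeGroupLie (ellipticPeriod (hτ k))) ≤ 3 := fun k ↦ by
    by_cases hb : ellipticEnd (hτ k) = ⊥
    · rw [finrank_hodgeGroupLie_ellipticPeriod_of_eq_bot (hτ k) hb]
    · rw [finrank_hodgeGroupLie_ellipticPeriod_of_ne_bot (hτ k) hb]; norm_num
  calc ∑ k, finrank ℝ (hodgeGroupLie (ellipticPeriod (hτ k))) ≤ ∑ _k : κ, 3 := Finset.sum_le_sum fun k _ ↦ hk k
    _ = 3 * Fintype.card κ := by rw [Finset.sum_const, smul_eq_mul, Finset.card_univ, mul_comm]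

/-- All `E_{τ_k}` CM ⟹ `dim_ℝ 𝔥𝔤_ℝ(∏ₖ E_{τ_k}^{n_k}) ≤ |κ|`. [cite: MoonenZarhin1999LowDim, §1 (p0002 L138–L141)]
[cite: Imai1976HodgeGroups, §2 (p. 368: "`Hg(E)` is a 1-dimensional torus if `E` is of CM-type")] -/
theorem finrank_hodgeGroupLie_sigmaPi_pow_ellipticPeriod_le_card_of_forall_ne_bot (hn : ∀ k, 0 < n k)
    (h : ∀ k, ellipticEnd (hτ k) ≠ ⊥) :
    finrank ℝ (hodgeGroupLie (sigmaPiPeriod fun k ↦ powPeriod (ellipticPeriod (hτ k)) (n k))) ≤ Fintype.card κ := by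
  refine (finrank_hodgeGroupLie_sigmaPi_pow_le (fun k ↦ ellipticPeriod (hτ k)) n hn).trans (le_of_eq ?_)
  rw [Finset.sum_congr rfl fun k _ ↦ finrank_hodgeGroupLie_ellipticPeriod_of_ne_bot (hτ k) (h k),
    Finset.sum_const, smul_eq_mul, mul_one, Finset.card_univ]

end Elliptic

end Literature.Geometry.Kaehler.ComplexTorus
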